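import Summits.HubbardSuperconductivity.HubbardSuperconductivity.Theorems.CwChiralConstruction.Negative.PressureSandwich
import Summits.HubbardSuperconductivity.HubbardSuperconductivity.Theorems.CwChiralConstruction.Negative.BandCounting
import Literature.MathematicalPhysics.QuantumLattice.PairFieldMomentum

/-!
# Crux `CwChiralConstruction` (item `stmt-HubbardSuperconductivity-1740`, route `ChiralWindow`):
# the grand-canonical ground-state density of the weakly interacting torus through the free band

Negative-side support lemmas from the standing disprover (cdisprove, cycle 2), part 3b (density pinning,
analytic half). For the grand-canonical torus `H_L(U,μ) = hubbardTorusWith 2 L 1 U μ` with tracial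
ground state `ω_{U,μ}` and ground energy `E_L(U,μ)`:

* `log_partitionFn_free_eq` — the FREE `log Z` in closed form (`L ≥ 3`):
  `log Tr e^{-β(H(1,0) - μN)} = Σ_k 2log(1 + e^{-β(ε_L(k) - μ)})` (from the tree's BdG product formula at
  zero source); `logZ_free_sub_ge` / `logZ_free_sub_le` — its `μ`-differences against band counts:
  `log Z₀(μ) - log Z₀(μ-η) ≥ 2(βη - log 2)·#{ε ≤ μ-η}`, `log Z₀(μ+η) - log Z₀(μ) ≤ 2βη·#{ε < μ+2η} + 2e^{-βη}L²`;
* `sub_mul_density_le` — concavity in `μ`: `(μ' - μ)·Re ω_{U,μ}(N) ≤ E_L(U,μ) - E_L(U,μ')`;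
* `groundEnergy_ge_free` / `groundEnergy_le_free` — `E_L(U,μ)` within `|U|L² + 2L² log 2/β` of the free
  `-log Z₀/β` (part 1's `Z`-sandwich and interacting-vs-free comparison);
* `density_mul_ge` / `density_mul_le` — the FINITE-VOLUME DENSITY SANDWICH (`L ≥ 3`, `η > 0`, `β → ∞`):
  `2η·#{ε_L(k) ≤ μ-η} - 2|U|L² ≤ η·Re ω_{U,μ}(N) ≤ 2η·#{ε_L(k) < μ+2η} + 2|U|L²`.

Sources: T. Koma, H. Tasaki, J. Stat. Phys. 76 (1994) 745, §1 (Hellmann–Feynman / concavity for the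
tracial ground state) [KomaTasaki1994]; free-fermion grand-canonical `Z` (folklore; tree
`partitionFn_dWaveSourceTorus_zero_re`, von Delft–Ralph 2001 §4.2).
-/

noncomputable section

namespace Summit.HubbardSuperconductivity.CwChiralConstruction.Negative

open Matrix Finset Filter Literature.MathematicalPhysics.QuantumLattice Literature.Probability.LatticeModels
open Summit.HubbardSuperconductivity.HubbardSuperconductivity.Theorems
open scoped Matrix.Norms.L2Operator ComplexOrder Topology

/-! ### E. The free grand-canonical torus: `log Z` in closed form and its `μ`-differences -/

section FreeGas

variable {L : ℕ} [NeZero L]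

/-- Per-mode factor at zero source: `e^{-y}(1 + cosh|y|… )/2 = (1 + e^{-y})²/4`, in logarithmic form. [folklore] -/
theorem log_bdgFactor_zero (β ξ g : ℝ) :
    Real.log (Real.exp (-(β * ξ)) *
        ((1 + Real.cosh (β * Real.sqrt (ξ ^ 2 + (2 * Real.sqrt 2 * 0 * g) ^ 2))) / 2)) =
      2 * Real.log (1 + Real.exp (-(β * ξ))) - Real.log 4 := by
  have hcosh : Real.cosh (β * Real.sqrt (ξ ^ 2 + (2 * Real.sqrt 2 * 0 * g) ^ 2)) = Real.cosh (β * ξ) := by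
    rw [mul_zero, zero_mul, zero_pow two_ne_zero, add_zero, Real.sqrt_sq_eq_abs]
    rcases abs_choice ξ with h | h
    · rw [h]
    · rw [h, mul_neg, Real.cosh_neg]
  rw [hcosh, Real.cosh_eq]
  set e := Real.exp (-(β * ξ)) with he
  have he' : Real.exp (β * ξ) = e⁻¹ := by rw [he, Real.exp_neg, inv_inv]
  have hepos : 0 < e := Real.exp_pos _
  have key : e * ((1 + (e⁻¹ + e) / 2) / 2) = (1 + e) ^ 2 / 4 := by
    field_simp
    ring
  rw [he', key, Real.log_div (by positivity) (by norm_num), Real.log_pow]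
  push_cast
  ring

/-- **The free grand-canonical `log Z`** (`L ≥ 3`): `log Tr e^{-β(H(1,0) - μN)} = Σ_k 2 log(1 + e^{-β(ε_L(k) - μ)})`
(free fermions, two spin states per momentum). [folklore] -/
theorem log_partitionFn_free_eq (hL : 3 ≤ L) (β μ : ℝ) :
    Real.log (partitionFn β (dWaveSourceTorus L 0 μ 0)).re =
      ∑ k : TorusSite 2 L, 2 * Real.log (1 + Real.exp (-(β * (torusBand L k - μ)))) := by
  rw [partitionFn_dWaveSourceTorus_zero_re hL]
  have hpow : (0 : ℝ) < (2 : ℝ) ^ Fintype.card (Orb (FermionTorus 2 L)) := by positivity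
  have hfac : ∀ k : TorusSite 2 L, Real.exp (-(β * (torusBand L k - μ))) *
      ((1 + Real.cosh (β * Real.sqrt ((torusBand L k - μ) ^ 2 + (2 * Real.sqrt 2 * 0 * dWaveGap k) ^ 2))) / 2) ≠ 0 :=
    fun k => (bdgModeFactor_pos β _ _).ne'
  rw [Real.log_mul hpow.ne' (Finset.prod_ne_zero_iff.2 fun k _ => hfac k),
    Real.log_prod (s := Finset.univ) (hf := fun k _ => hfac k), Real.log_pow, card_orb_fermionTorus_two]
  simp_rw [log_bdgFactor_zero]
  rw [Finset.sum_sub_distrib, Finset.sum_const, Finset.card_univ]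
  have hcard : Fintype.card (TorusSite 2 L) = L ^ 2 := by
    simp [TorusSite, ZMod.card]
  rw [hcard, nsmul_eq_mul, show (4 : ℝ) = 2 ^ 2 by norm_num, Real.log_pow]
  push_cast
  ring

/-- **Lower `μ`-difference of the free `log Z`.** For `β > 0`, `η ≥ 0`, `L ≥ 3`:
`log Z₀(μ) - log Z₀(μ - η) ≥ 2(βη - log 2)·#{k : ε_L(k) ≤ μ - η}`. [folklore] -/
theorem logZ_free_sub_ge (hL : 3 ≤ L) {β η : ℝ} (hβ : 0 < β) (hη : 0 ≤ η) (μ : ℝ) :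
    2 * (β * η - Real.log 2) * ((Finset.univ.filter fun k : TorusSite 2 L => torusBand L k ≤ μ - η).card : ℝ) ≤
      Real.log (partitionFn β (dWaveSourceTorus L 0 μ 0)).re -
        Real.log (partitionFn β (dWaveSourceTorus L 0 (μ - η) 0)).re := by
  rw [log_partitionFn_free_eq hL, log_partitionFn_free_eq hL, ← Finset.sum_sub_distrib]
  set F : TorusSite 2 L → ℝ := fun k => 2 * Real.log (1 + Real.exp (-(β * (torusBand L k - μ)))) -
      2 * Real.log (1 + Real.exp (-(β * (torusBand L k - (μ - η)))))
  have hF0 : ∀ k, 0 ≤ F k := fun k => by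
    have := log_one_add_exp_mono (x := -(β * (torusBand L k - (μ - η)))) (y := -(β * (torusBand L k - μ)))
      (by nlinarith)
    simp only [F]; linarith
  have hF1 : ∀ k ∈ (Finset.univ.filter fun k : TorusSite 2 L => torusBand L k ≤ μ - η),
      2 * (β * η - Real.log 2) ≤ F k := by
    intro k hk
    have hk' := (Finset.mem_filter.1 hk).2
    have h1 := le_log_one_add_exp (-(β * (torusBand L k - μ)))
    have h2 := log_one_add_exp_le (x := -(β * (torusBand L k - (μ - η)))) (by nlinarith)
    simp only [F]
    nlinarith
  calc 2 * (β * η - Real.log 2) * ((Finset.univ.filter fun k : TorusSite 2 L => torusBand L k ≤ μ - η).card : ℝ)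
      = ∑ _k ∈ (Finset.univ.filter fun k : TorusSite 2 L => torusBand L k ≤ μ - η), 2 * (β * η - Real.log 2) := by
        rw [Finset.sum_const, nsmul_eq_mul]; ring
    _ ≤ ∑ k ∈ (Finset.univ.filter fun k : TorusSite 2 L => torusBand L k ≤ μ - η), F k :=
        Finset.sum_le_sum hF1
    _ ≤ ∑ k, F k :=
        Finset.sum_le_sum_of_subset_of_nonneg (Finset.filter_subset _ _) fun k _ _ => hF0 k

/-- **Upper `μ`-difference of the free `log Z`.** For `β > 0`, `η ≥ 0`, `L ≥ 3`:
`log Z₀(μ + η) - log Z₀(μ) ≤ 2βη·#{k : ε_L(k) < μ + 2η} + 2e^{-βη}·L²`. [folklore] -/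
theorem logZ_free_sub_le (hL : 3 ≤ L) {β η : ℝ} (hβ : 0 < β) (hη : 0 ≤ η) (μ : ℝ) :
    Real.log (partitionFn β (dWaveSourceTorus L 0 (μ + η) 0)).re -
        Real.log (partitionFn β (dWaveSourceTorus L 0 μ 0)).re ≤
      2 * (β * η) * ((Finset.univ.filter fun k : TorusSite 2 L => torusBand L k < μ + 2 * η).card : ℝ) +
        2 * Real.exp (-(β * η)) * (L : ℝ) ^ 2 := by
  classical
  rw [log_partitionFn_free_eq hL, log_partitionFn_free_eq hL, ← Finset.sum_sub_distrib]
  set F : TorusSite 2 L → ℝ := fun k => 2 * Real.log (1 + Real.exp (-(β * (torusBand L k - (μ + η))))) -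
      2 * Real.log (1 + Real.exp (-(β * (torusBand L k - μ))))
  set P : TorusSite 2 L → Prop := fun k => torusBand L k < μ + 2 * η
  have hFa : ∀ k, F k ≤ 2 * (β * η) := fun k => by
    have := log_one_add_exp_add_le (x := -(β * (torusBand L k - μ))) (t := β * η) (by positivity)
    rw [show -(β * (torusBand L k - μ)) + β * η = -(β * (torusBand L k - (μ + η))) by ring] at this
    simp only [F]; linarith
  have hFb : ∀ k, ¬ P k → F k ≤ 2 * Real.exp (-(β * η)) := fun k hk => by
    have hk' : μ + 2 * η ≤ torusBand L k := le_of_not_gt hk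
    have h1 := log_one_add_exp_le_exp (-(β * (torusBand L k - (μ + η))))
    have h2 : Real.exp (-(β * (torusBand L k - (μ + η)))) ≤ Real.exp (-(β * η)) :=
      Real.exp_le_exp.2 (by nlinarith)
    have h3 : 0 ≤ 2 * Real.log (1 + Real.exp (-(β * (torusBand L k - μ)))) := by
      have := Real.log_nonneg (show (1:ℝ) ≤ 1 + Real.exp (-(β * (torusBand L k - μ))) by
        linarith [Real.exp_pos (-(β * (torusBand L k - μ)))])
      linarith
    simp only [F]; linarith
  rw [← Finset.sum_filter_add_sum_filter_not Finset.univ P]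
  have hcardL : ((Finset.univ.filter fun k => ¬ P k).card : ℝ) ≤ (L : ℝ) ^ 2 := by
    have h1 : (Finset.univ.filter fun k => ¬ P k).card ≤ Fintype.card (TorusSite 2 L) :=
      Finset.card_filter_le _ _ |>.trans (Finset.card_univ (α := TorusSite 2 L)).le
    have hcard : Fintype.card (TorusSite 2 L) = L ^ 2 := by
      simp [TorusSite, ZMod.card]
    rw [hcard] at h1
    exact_mod_cast h1
  have hexp : 0 ≤ 2 * Real.exp (-(β * η)) := by positivity
  calc ∑ k ∈ Finset.univ.filter P, F k + ∑ k ∈ Finset.univ.filter (fun k => ¬ P k), F k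
      ≤ ∑ _k ∈ Finset.univ.filter P, 2 * (β * η) +
          ∑ _k ∈ Finset.univ.filter (fun k => ¬ P k), 2 * Real.exp (-(β * η)) :=
        add_le_add (Finset.sum_le_sum fun k _ => hFa k)
          (Finset.sum_le_sum fun k hk => hFb k (Finset.mem_filter.1 hk).2)
    _ = 2 * (β * η) * ((Finset.univ.filter P).card : ℝ) +
          2 * Real.exp (-(β * η)) * ((Finset.univ.filter fun k => ¬ P k).card : ℝ) := by
        rw [Finset.sum_const, Finset.sum_const, nsmul_eq_mul, nsmul_eq_mul]; ring
    _ ≤ 2 * (β * η) * ((Finset.univ.filter P).card : ℝ) + 2 * Real.exp (-(β * η)) * (L : ℝ) ^ 2 := by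
        have := mul_le_mul_of_nonneg_left hcardL hexp
        linarith

end FreeGas

/-! ### F. The interacting grand-canonical torus: finite-volume density sandwich -/

section Density

variable {L : ℕ} [NeZero L]

omit [NeZero L] in
/-- **Concavity in `μ` (Hellmann–Feynman for the tracial ground state).** For all `μ, μ'`:
`(μ' - μ)·Re ω_{U,μ}(N) ≤ E_L(U,μ) - E_L(U,μ')`, `E_L(U,μ) = E₀(H(1,U) - μN)`. [cite: KomaTasaki1994, §1] -/
theorem sub_mul_density_le (U μ μ' : ℝ) :
    (μ' - μ) * ((hubbardTorusWith 2 L 1 U μ).groundStateFunctional totalNumber).re ≤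
      (hubbardTorusWith 2 L 1 U μ).groundEnergy - (hubbardTorusWith 2 L 1 U μ').groundEnergy := by
  have hK : (hubbardTorus 2 L 1 U).IsHermitian := by simpa using isHermitian_hubbardTorusWith L 1 U 0
  exact sub_mul_re_groundStateFunctional_le hK totalNumber_isHermitian μ μ'

/-- **Ground energy from below through the free `log Z`** (`L ≥ 3`, `β > 0`):
`-Σ_k 2log(1 + e^{-β(ε_k - μ)})/β - |U|L² ≤ E_L(U,μ)`. [folklore] -/
theorem groundEnergy_ge_free (hL : 3 ≤ L) (U μ : ℝ) {β : ℝ} (hβ : 0 < β) :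
    -(∑ k : TorusSite 2 L, 2 * Real.log (1 + Real.exp (-(β * (torusBand L k - μ))))) / β - |U| * (L : ℝ) ^ 2 ≤
      (hubbardTorusWith 2 L 1 U μ).groundEnergy := by
  rw [← dWaveSourceTorus_zero, ← log_partitionFn_free_eq hL β μ]
  have h1 := neg_log_partitionFn_div_le_groundEnergy (isHermitian_dWaveSourceTorus L U μ 0) hβ
  have h2 := abs_log_partitionFn_interacting_sub_free_le (L := L) U μ 0 hβ
  rw [abs_le] at h2
  have h3 : -Real.log (partitionFn β (dWaveSourceTorus L 0 μ 0)).re / β - |U| * (L : ℝ) ^ 2 ≤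
      -Real.log (partitionFn β (dWaveSourceTorus L U μ 0)).re / β := by
    rw [sub_le_iff_le_add, div_add' _ _ _ hβ.ne', div_le_div_iff_of_pos_right hβ]
    nlinarith [h2.2]
  exact h3.trans h1

/-- **Ground energy from above through the free `log Z`** (`L ≥ 3`, `β > 0`):
`E_L(U,μ) ≤ (2L² log 2 - Σ_k 2log(1 + e^{-β(ε_k - μ)}))/β + |U|L²`. [folklore] -/
theorem groundEnergy_le_free (hL : 3 ≤ L) (U μ : ℝ) {β : ℝ} (hβ : 0 < β) :
    (hubbardTorusWith 2 L 1 U μ).groundEnergy ≤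
      (2 * (L : ℝ) ^ 2 * Real.log 2 -
          ∑ k : TorusSite 2 L, 2 * Real.log (1 + Real.exp (-(β * (torusBand L k - μ))))) / β +
        |U| * (L : ℝ) ^ 2 := by
  rw [← dWaveSourceTorus_zero, ← log_partitionFn_free_eq hL β μ]
  have h1 := groundEnergy_le_log_card_sub_log_partitionFn_div (isHermitian_dWaveSourceTorus L U μ 0) hβ
  rw [log_card_fock] at h1
  have h2 := abs_log_partitionFn_interacting_sub_free_le (L := L) U μ 0 hβ
  rw [abs_le] at h2
  refine h1.trans ?_
  have h3 : (2 * (L : ℝ) ^ 2 * Real.log 2 - Real.log (partitionFn β (dWaveSourceTorus L U μ 0)).re) / β -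
      (2 * (L : ℝ) ^ 2 * Real.log 2 - Real.log (partitionFn β (dWaveSourceTorus L 0 μ 0)).re) / β ≤
        |U| * (L : ℝ) ^ 2 := by
    rw [div_sub_div_same, div_le_iff₀ hβ]
    nlinarith [h2.1]
  linarith

/-- **Finite-volume density from below** (`L ≥ 3`, `η > 0`):
`2η·#{k : ε_L(k) ≤ μ - η} - 2|U|L² ≤ η·Re ω_{U,μ}(N)`. [folklore] -/
theorem density_mul_ge (hL : 3 ≤ L) (U μ : ℝ) {η : ℝ} (hη : 0 < η) :
    2 * η * ((Finset.univ.filter fun k : TorusSite 2 L => torusBand L k ≤ μ - η).card : ℝ) -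
        2 * |U| * (L : ℝ) ^ 2 ≤
      η * ((hubbardTorusWith 2 L 1 U μ).groundStateFunctional totalNumber).re := by
  set N := ((Finset.univ.filter fun k : TorusSite 2 L => torusBand L k ≤ μ - η).card : ℝ) with hN
  set n := ((hubbardTorusWith 2 L 1 U μ).groundStateFunctional totalNumber).re
  have hNL : N ≤ (L : ℝ) ^ 2 := by
    have h1 : (Finset.univ.filter fun k : TorusSite 2 L => torusBand L k ≤ μ - η).card ≤
        Fintype.card (TorusSite 2 L) :=
      Finset.card_filter_le _ _ |>.trans (Finset.card_univ (α := TorusSite 2 L)).le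
    have hcard : Fintype.card (TorusSite 2 L) = L ^ 2 := by simp [TorusSite, ZMod.card]
    rw [hcard] at h1
    rw [hN]
    exact_mod_cast h1
  -- for every `β > 0`
  have key : ∀ β : ℝ, 0 < β → 2 * η * N - 2 * |U| * (L : ℝ) ^ 2 - 4 * (L : ℝ) ^ 2 * Real.log 2 / β ≤ η * n := by
    intro β hβ
    have hconc := sub_mul_density_le (L := L) U μ (μ - η)
    have hE1 := groundEnergy_ge_free hL U (μ - η) hβ
    have hE2 := groundEnergy_le_free hL U μ hβ
    have hZ := logZ_free_sub_ge hL hβ hη.le μ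
    rw [log_partitionFn_free_eq hL, log_partitionFn_free_eq hL] at hZ
    set S1 := ∑ k : TorusSite 2 L, 2 * Real.log (1 + Real.exp (-(β * (torusBand L k - μ))))
    set S2 := ∑ k : TorusSite 2 L, 2 * Real.log (1 + Real.exp (-(β * (torusBand L k - (μ - η)))))
    -- `η n ≥ E(μ-η) - E(μ) ≥ (S1 - S2)/β - 2L² log 2/β - 2|U|L²`
    have h1 : (S1 - S2) / β - 2 * (L : ℝ) ^ 2 * Real.log 2 / β - 2 * |U| * (L : ℝ) ^ 2 ≤ η * n := by
      have e : (S1 - S2) / β - 2 * (L : ℝ) ^ 2 * Real.log 2 / β =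
          -S2 / β - (2 * (L : ℝ) ^ 2 * Real.log 2 - S1) / β := by
        rw [div_sub_div_same, div_sub_div_same]
        congr 1
        ring
      have hc : μ - η - μ = -η := by ring
      rw [hc] at hconc
      linarith [hconc, hE1, hE2, e]
    have h2 : 2 * (β * η - Real.log 2) * N / β ≤ (S1 - S2) / β := div_le_div_of_nonneg_right hZ hβ.le
    have h3 : 2 * η * N - 2 * |U| * (L : ℝ) ^ 2 - 4 * (L : ℝ) ^ 2 * Real.log 2 / β ≤
        2 * (β * η - Real.log 2) * N / β - 2 * (L : ℝ) ^ 2 * Real.log 2 / β - 2 * |U| * (L : ℝ) ^ 2 := by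
      have hlog2 : 0 ≤ Real.log 2 := Real.log_nonneg one_le_two
      have e : 2 * (β * η - Real.log 2) * N / β = 2 * η * N - 2 * Real.log 2 * N / β := by
        rw [show 2 * (β * η - Real.log 2) * N = β * (2 * η * N) - 2 * Real.log 2 * N by ring, sub_div,
          mul_div_cancel_left₀ _ hβ.ne']
      rw [e]
      have : 2 * Real.log 2 * N / β ≤ 2 * (L : ℝ) ^ 2 * Real.log 2 / β :=
        div_le_div_of_nonneg_right (by nlinarith) hβ.le
      have e2 : 4 * (L : ℝ) ^ 2 * Real.log 2 / β = 2 * (L : ℝ) ^ 2 * Real.log 2 / β + 2 * (L : ℝ) ^ 2 * Real.log 2 / β := by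
        rw [← add_div]
        congr 1
        ring
      rw [e2]
      linarith
    linarith
  -- `β → ∞`
  have hlim : Tendsto (fun β : ℝ => 2 * η * N - 2 * |U| * (L : ℝ) ^ 2 - 4 * (L : ℝ) ^ 2 * Real.log 2 / β)
      atTop (𝓝 (2 * η * N - 2 * |U| * (L : ℝ) ^ 2 - 0)) :=
    tendsto_const_nhds.sub (tendsto_const_nhds.div_atTop tendsto_id)
  rw [sub_zero] at hlim
  exact le_of_tendsto hlim (by
    filter_upwards [eventually_gt_atTop (0 : ℝ)] with β hβ using key β hβ)

/-- **Finite-volume density from above** (`L ≥ 3`, `η > 0`):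
`η·Re ω_{U,μ}(N) ≤ 2η·#{k : ε_L(k) < μ + 2η} + 2|U|L²`. [folklore] -/
theorem density_mul_le (hL : 3 ≤ L) (U μ : ℝ) {η : ℝ} (hη : 0 < η) :
    η * ((hubbardTorusWith 2 L 1 U μ).groundStateFunctional totalNumber).re ≤
      2 * η * ((Finset.univ.filter fun k : TorusSite 2 L => torusBand L k < μ + 2 * η).card : ℝ) +
        2 * |U| * (L : ℝ) ^ 2 := by
  set N := ((Finset.univ.filter fun k : TorusSite 2 L => torusBand L k < μ + 2 * η).card : ℝ) with hN
  set n := ((hubbardTorusWith 2 L 1 U μ).groundStateFunctional totalNumber).re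
  have key : ∀ β : ℝ, 0 < β → η * n ≤ 2 * η * N + 2 * |U| * (L : ℝ) ^ 2 + (2 + 2 * Real.log 2) * (L : ℝ) ^ 2 / β := by
    intro β hβ
    have hconc := sub_mul_density_le (L := L) U μ (μ + η)
    have hE1 := groundEnergy_ge_free hL U (μ + η) hβ
    have hE2 := groundEnergy_le_free hL U μ hβ
    have hZ := logZ_free_sub_le hL hβ hη.le μ
    rw [log_partitionFn_free_eq hL, log_partitionFn_free_eq hL] at hZ
    set S1 := ∑ k : TorusSite 2 L, 2 * Real.log (1 + Real.exp (-(β * (torusBand L k - (μ + η)))))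
    set S2 := ∑ k : TorusSite 2 L, 2 * Real.log (1 + Real.exp (-(β * (torusBand L k - μ))))
    have h1 : η * n ≤ (S1 - S2) / β + 2 * (L : ℝ) ^ 2 * Real.log 2 / β + 2 * |U| * (L : ℝ) ^ 2 := by
      have e : (2 * (L : ℝ) ^ 2 * Real.log 2 - S2) / β - -S1 / β =
          (S1 - S2) / β + 2 * (L : ℝ) ^ 2 * Real.log 2 / β := by
        rw [div_sub_div_same, ← add_div]
        congr 1
        ring
      have hc : μ + η - μ = η := by ring
      rw [hc] at hconc
      linarith [hconc, hE1, hE2, e]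
    have h2 : (S1 - S2) / β ≤ (2 * (β * η) * N + 2 * Real.exp (-(β * η)) * (L : ℝ) ^ 2) / β :=
      div_le_div_of_nonneg_right hZ hβ.le
    have h3 : (2 * (β * η) * N + 2 * Real.exp (-(β * η)) * (L : ℝ) ^ 2) / β ≤ 2 * η * N + 2 * (L : ℝ) ^ 2 / β := by
      have hexp : Real.exp (-(β * η)) ≤ 1 := Real.exp_le_one_iff.mpr (by nlinarith)
      have e : (2 * (β * η) * N + 2 * Real.exp (-(β * η)) * (L : ℝ) ^ 2) / β =
          2 * η * N + 2 * Real.exp (-(β * η)) * (L : ℝ) ^ 2 / β := by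
        rw [add_div, show 2 * (β * η) * N = β * (2 * η * N) by ring, mul_div_cancel_left₀ _ hβ.ne']
      rw [e]
      have : 2 * Real.exp (-(β * η)) * (L : ℝ) ^ 2 / β ≤ 2 * (L : ℝ) ^ 2 / β :=
        div_le_div_of_nonneg_right (by nlinarith [sq_nonneg (L : ℝ), Real.exp_pos (-(β * η))]) hβ.le
      linarith
    have e3 : (2 + 2 * Real.log 2) * (L : ℝ) ^ 2 / β = 2 * (L : ℝ) ^ 2 / β + 2 * (L : ℝ) ^ 2 * Real.log 2 / β := by
      rw [← add_div]
      congr 1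
      ring
    rw [e3]
    linarith
  have hlim : Tendsto (fun β : ℝ => 2 * η * N + 2 * |U| * (L : ℝ) ^ 2 + (2 + 2 * Real.log 2) * (L : ℝ) ^ 2 / β)
      atTop (𝓝 (2 * η * N + 2 * |U| * (L : ℝ) ^ 2 + 0)) :=
    tendsto_const_nhds.add (tendsto_const_nhds.div_atTop tendsto_id)
  rw [add_zero] at hlim
  exact ge_of_tendsto hlim (by
    filter_upwards [eventually_gt_atTop (0 : ℝ)] with β hβ using key β hβ)

end Density

end Summit.HubbardSuperconductivity.CwChiralConstruction.Negative

end
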